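import Mathlib
import Summits.NavierStokesRegularity.NavierStokesRegularity.Theorems.TypeIQuarterGateScarEnvelopeTypeIZoomDictionaryDefs
import Summits.NavierStokesRegularity.NavierStokesRegularity.Theorems.TypeIQuarterGateScarEnvelopeTypeIZoomDictionaryLemmas
import Summits.NavierStokesRegularity.NavierStokesRegularity.Theorems.TypeIQuarterGateScarEnvelopeTypeIZoomDictionaryUnit

/-!
# Part D: `PersistenceU` is a theorem (A–B Prop. 2.3 in the tree) and the dictionary with F2, F3 discharged

Part D of the plate, section `PersistenceBridge`: `persistenceU_holds` from the tree's `PersistenceOfSingularities_holds`, then `dictionaryU'` / `octaveBudget_iff_noSatelliteU'` / `dictionaryU_of_classical'`.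

PROVENANCE: declaration texts VERBATIM from the HOME plates of the instrument seat nsreg-p3 (g24/g25, cell
`pub/ns-regularity-ideate`): `round-31/Tangent31prep.lean` v5 (sha16 `e5b8668e3a090216`; = ROUND-30 plate v10 + Part K) and,
for Part L, `round-32/Tangent32prep.lean` v6 (sha16 `6123f27718636121`);
the author cannot write under `Theorems/` (`perm.theorems-prover-only`); landed by the
LEAD-lineage prover ns-sz-p1 g5 on director-ns DIRECTOR-NS #218 (2), split into ≤ 400-line modules (the
plate's `def`s gathered in `TypeIQuarterGateScarEnvelopeTypeIZoomDictionaryDefs`), namespace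
`Summit.NavierStokesRegularity.NavierStokesRegularity.Cruxes.ScarEnvelopeTypeI.ZoomDictionary` (the plate's `NsregP3.R30P`), `E3` spelled out, one-line docstrings
added where the plate had none.  `--supports stmt-NavierStokesRegularity-23843 --as helper`.

HONEST FRAMING: dictionary / census TOOLING for the crux `TypeIQuarterGate.ScarEnvelopeTypeI` (item 23843):
equivalences and normal forms, kernel-checked; NO open statement is proved — 23843, its parent
`QuarterLawTypeI` (23726), the route and Navier–Stokes regularity are OPEN; hard core evaded: none.
-/

-- the summit-side namespace repeats a component by design (single-conjunct summit, D-0017)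
set_option linter.dupNamespace false

open MeasureTheory Set Metric Filter Topology
open scoped ENNReal

namespace Summit.NavierStokesRegularity.NavierStokesRegularity.Cruxes.ScarEnvelopeTypeI.ZoomDictionary

variable {u : ℝ → (EuclideanSpace ℝ (Fin 3)) → (EuclideanSpace ℝ (Fin 3))} {a : (EuclideanSpace ℝ (Fin 3))} {ν T : ℝ}

section UnitNormalisation

open Literature.Analysis.FluidPDE
variable {u : ℝ → (EuclideanSpace ℝ (Fin 3)) → (EuclideanSpace ℝ (Fin 3))} {p : ℝ → (EuclideanSpace ℝ (Fin 3)) → ℝ} {a : (EuclideanSpace ℝ (Fin 3))} {T : ℝ}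

section PersistenceBridge

variable {G : Type*} [NormedAddCommGroup G] [NormedSpace ℝ G]

/-- The parabolic affine map `stAffine ρ² ρ 0 y` sends the origin to `(0, y)`. [folklore] -/
theorem stAffine_sq_zero {ρ : ℝ} (y : (EuclideanSpace ℝ (Fin 3))) : stAffine (ρ ^ 2) ρ 0 y (0 : ℝ × (EuclideanSpace ℝ (Fin 3))) = ((0 : ℝ), y) := by
  rw [show (0 : ℝ × (EuclideanSpace ℝ (Fin 3))) = ((0 : ℝ), (0 : (EuclideanSpace ℝ (Fin 3)))) from rfl, stAffine_apply]; simp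

/-- `Φ⁻¹ Q_{ρR}(0, y) = Q_R(0)`. -/
theorem preimage_zoomAt {ρ : ℝ} (hρ : 0 < ρ) (y : (EuclideanSpace ℝ (Fin 3))) (R : ℝ) :
    stAffine (ρ ^ 2) ρ 0 y ⁻¹' parabolicCylinder (ρ * R) ((0 : ℝ), y) =
      parabolicCylinder R (0 : ℝ × (EuclideanSpace ℝ (Fin 3))) := by
  have h := LocalTypeIScaling.stAffine_preimage_parabolicCylinder hρ 0 y R 0
  rwa [stAffine_sq_zero] at h

/-- The inverse parabolic affine map sends `(0, y)` back to the origin. [folklore] -/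
theorem stAffine_inv_base {ρ : ℝ} (y : (EuclideanSpace ℝ (Fin 3))) :
    stAffine (ρ⁻¹ ^ 2) ρ⁻¹ 0 (-(ρ⁻¹ • y)) ((0 : ℝ), y) = (0 : ℝ × (EuclideanSpace ℝ (Fin 3))) := by
  rw [stAffine_apply, show (0 : ℝ × (EuclideanSpace ℝ (Fin 3))) = ((0 : ℝ), (0 : (EuclideanSpace ℝ (Fin 3)))) from rfl]; simp

/-- `Ψ⁻¹ Q_R(0) = Q_{ρR}(0, y)`. -/
theorem preimage_zoomAt_inv {ρ : ℝ} (hρ : 0 < ρ) (y : (EuclideanSpace ℝ (Fin 3))) (R : ℝ) :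
    stAffine (ρ⁻¹ ^ 2) ρ⁻¹ 0 (-(ρ⁻¹ • y)) ⁻¹' parabolicCylinder R (0 : ℝ × (EuclideanSpace ℝ (Fin 3))) =
      parabolicCylinder (ρ * R) ((0 : ℝ), y) := by
  have h := LocalTypeIScaling.stAffine_preimage_parabolicCylinder (inv_pos.2 hρ) 0 (-(ρ⁻¹ • y))
    (ρ * R) ((0 : ℝ), y)
  rwa [stAffine_inv_base, inv_mul_cancel_left₀ hρ.ne'] at h

/-- `Ψ ∘ Φ = id`. -/
theorem stAffine_inv_comp {ρ : ℝ} (hρ : ρ ≠ 0) (y : (EuclideanSpace ℝ (Fin 3))) (w : ℝ × (EuclideanSpace ℝ (Fin 3))) :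
    stAffine (ρ⁻¹ ^ 2) ρ⁻¹ 0 (-(ρ⁻¹ • y)) (stAffine (ρ ^ 2) ρ 0 y w) = w := by
  obtain ⟨t, x⟩ := w
  simp only [stAffine_apply, Prod.mk.injEq, zero_add, smul_add, smul_smul, inv_mul_cancel₀ hρ,
    one_smul]
  refine ⟨?_, ?_⟩
  · rw [← mul_assoc, ← mul_pow, inv_mul_cancel₀ hρ, one_pow, one_mul]
  · abel

/-- `L^r` norms of fields zoomed about `(0, y)`: `‖c f∘Φ‖_{L^r(Q_R(0))} = |c| (ρ⁵)^{-1/r} ‖f‖_{L^r(Q_{ρR}(0,y))}`. -/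
theorem eLpNorm_zoomAt {ρ : ℝ} (hρ : 0 < ρ) (y : (EuclideanSpace ℝ (Fin 3))) (c : ℝ) (f : ℝ → (EuclideanSpace ℝ (Fin 3)) → G) (R : ℝ)
    {r : ℝ≥0∞} (hr0 : r ≠ 0) (hrtop : r ≠ ⊤) :
    eLpNorm (Function.uncurry (c • stPull (ρ ^ 2) ρ 0 y f)) r
        (volume.restrict (parabolicCylinder R (0 : ℝ × (EuclideanSpace ℝ (Fin 3))))) =
      ‖c‖ₑ * (ENNReal.ofReal (ρ ^ 2 * ρ ^ 3)⁻¹) ^ (1 / r.toReal) *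
        eLpNorm (Function.uncurry f) r
          (volume.restrict (parabolicCylinder (ρ * R) ((0 : ℝ), y))) := by
  have e : Function.uncurry (c • stPull (ρ ^ 2) ρ 0 y f) =
      c • (Function.uncurry f ∘ stAffine (ρ ^ 2) ρ 0 y) := by
    funext z; rfl
  rw [e, eLpNorm_const_smul, ← preimage_zoomAt hρ y R,
    eLpNorm_comp_stAffine_preimage (pow_pos hρ 2) hρ 0 y (Function.uncurry f) _ hr0 hrtop,
    mul_assoc]

/-- Pressure pairings under the zoom about `(0, y)`, the test function transported along `Ψ`. -/
theorem setIntegral_zoomAt_pressure_mul {ρ : ℝ} (hρ : 0 < ρ) (y : (EuclideanSpace ℝ (Fin 3))) (b : ℝ)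
    (π : ℝ → (EuclideanSpace ℝ (Fin 3)) → ℝ) (g : ℝ × (EuclideanSpace ℝ (Fin 3)) → ℝ) (R : ℝ) :
    ∫ w in parabolicCylinder R (0 : ℝ × (EuclideanSpace ℝ (Fin 3))), (b • stPull (ρ ^ 2) ρ 0 y π) w.1 w.2 * g w =
      b * (ρ ^ 2 * ρ ^ 3)⁻¹ * ∫ w in parabolicCylinder (ρ * R) ((0 : ℝ), y),
        π w.1 w.2 * g (stAffine (ρ⁻¹ ^ 2) ρ⁻¹ 0 (-(ρ⁻¹ • y)) w) := by
  have h1 := setIntegral_preimage_comp_stAffine (pow_pos hρ 2) hρ 0 y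
    (fun z : ℝ × (EuclideanSpace ℝ (Fin 3)) => b * (π z.1 z.2 * g (stAffine (ρ⁻¹ ^ 2) ρ⁻¹ 0 (-(ρ⁻¹ • y)) z)))
    (parabolicCylinder (ρ * R) ((0 : ℝ), y))
  rw [preimage_zoomAt hρ y R, finrank_euclideanSpace_fin] at h1
  have e : ∀ w : ℝ × (EuclideanSpace ℝ (Fin 3)), (b • stPull (ρ ^ 2) ρ 0 y π) w.1 w.2 * g w =
      (fun z : ℝ × (EuclideanSpace ℝ (Fin 3)) => b * (π z.1 z.2 * g (stAffine (ρ⁻¹ ^ 2) ρ⁻¹ 0 (-(ρ⁻¹ • y)) z)))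
        (stAffine (ρ ^ 2) ρ 0 y w) := by
    intro w
    simp only [stAffine_inv_comp hρ.ne', smul_stPull_apply, smul_eq_mul, stAffine_fst,
      stAffine_snd]
    ring
  simp_rw [e]
  rw [h1, integral_const_mul, smul_eq_mul]
  ring

/-- Test functions transported along `Ψ` stay in `L³`. -/
theorem memLp_comp_zoomAt_inv {ρ : ℝ} (hρ : 0 < ρ) (y : (EuclideanSpace ℝ (Fin 3))) {g : ℝ × (EuclideanSpace ℝ (Fin 3)) → ℝ} {R : ℝ}
    (hg : MemLp g 3 (volume.restrict (parabolicCylinder R (0 : ℝ × (EuclideanSpace ℝ (Fin 3)))))) :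
    MemLp (fun w => g (stAffine (ρ⁻¹ ^ 2) ρ⁻¹ 0 (-(ρ⁻¹ • y)) w)) 3
      (volume.restrict (parabolicCylinder (ρ * R) ((0 : ℝ), y))) := by
  have hγ : 0 < ρ⁻¹ := inv_pos.2 hρ
  have hβ : 0 < ρ⁻¹ ^ 2 := pow_pos hγ 2
  rw [← preimage_zoomAt_inv hρ y R]
  change MemLp (g ∘ stAffine (ρ⁻¹ ^ 2) ρ⁻¹ 0 (-(ρ⁻¹ • y))) 3 _
  refine ⟨?_, ?_⟩
  · refine hg.1.comp_quasiMeasurePreserving ⟨measurable_stAffine _ _ _ _, ?_⟩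
    rw [map_stAffine_volume_restrict_preimage hβ hγ]
    exact Measure.smul_absolutelyContinuous
  · rw [eLpNorm_comp_stAffine_preimage hβ hγ 0 _ g _ (by norm_num) (by norm_num)]
    exact ENNReal.mul_lt_top (ENNReal.rpow_lt_top_of_nonneg (by positivity) ENNReal.ofReal_ne_top)
      hg.2

/-- **`PersistenceU` holds** — by the tree's A–B Prop. 2.3 (`PersistenceOfSingularities_holds`),
after zooming `Q_ρ(0, y)` onto `Q_1(0)`; the `limsup = ∞` hypothesis of the fact is produced by
contradiction from the negated conclusion, and the fact's conclusion (`ū∘Φ` singular at `0`)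
contradicts the essential bound on `ū` near `(0, y)`. -/
theorem persistenceU_holds : PersistenceU := by
  intro v q ū pbar y ρ hρ h1 h2 h3 h4 h5 h6
  have hρ2 : 0 < ρ ^ 2 := pow_pos hρ 2
  have hρne : ρ ≠ 0 := hρ.ne'
  -- (1) the zoomed pairs are in A–B's class on the unit ball
  have A1 : ∀ k, IsSuitableWeakSolutionInBall 1 (0 : ℝ × (EuclideanSpace ℝ (Fin 3))) (ρ • stPull (ρ ^ 2) ρ 0 y (v k))
      (ρ ^ 2 • stPull (ρ ^ 2) ρ 0 y (q k)) := fun k => (h1 k).zoom hρ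
  have A2 : IsSuitableWeakSolutionInBall 1 (0 : ℝ × (EuclideanSpace ℝ (Fin 3))) (ρ • stPull (ρ ^ 2) ρ 0 y ū)
      (ρ ^ 2 • stPull (ρ ^ 2) ρ 0 y pbar) := h2.zoom hρ
  -- constants
  have hc3 : ‖ρ‖ₑ * (ENNReal.ofReal (ρ ^ 2 * ρ ^ 3)⁻¹) ^ (1 / (3 : ℝ≥0∞).toReal) < ⊤ :=
    ENNReal.mul_lt_top enorm_lt_top
      (ENNReal.rpow_lt_top_of_nonneg (by positivity) ENNReal.ofReal_ne_top)
  have hc32 : ‖ρ ^ 2‖ₑ * (ENNReal.ofReal (ρ ^ 2 * ρ ^ 3)⁻¹) ^ (1 / (3 / 2 : ℝ≥0∞).toReal) < ⊤ :=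
    ENNReal.mul_lt_top enorm_lt_top
      (ENNReal.rpow_lt_top_of_nonneg (by positivity) ENNReal.ofReal_ne_top)
  have h32top : (3 / 2 : ℝ≥0∞) ≠ ⊤ := ENNReal.div_ne_top (by norm_num) (by norm_num)
  have h32ne : (3 / 2 : ℝ≥0∞) ≠ 0 := by norm_num
  -- (2) the uniform bound on `Q_1(0)`
  have A3 : (⨆ k, eLpNorm (Function.uncurry (ρ • stPull (ρ ^ 2) ρ 0 y (v k))) 3
        (volume.restrict (parabolicCylinder 1 (0 : ℝ × (EuclideanSpace ℝ (Fin 3))))) +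
      eLpNorm (Function.uncurry (ρ ^ 2 • stPull (ρ ^ 2) ρ 0 y (q k))) (3 / 2)
        (volume.restrict (parabolicCylinder 1 (0 : ℝ × (EuclideanSpace ℝ (Fin 3)))))) < ⊤ := by
    refine lt_of_le_of_lt (iSup_le fun k => ?_) (ENNReal.mul_lt_top (ENNReal.add_lt_top.2 ⟨hc3, hc32⟩) h3)
    rw [eLpNorm_zoomAt hρ y ρ (v k) 1 (by norm_num) (by norm_num),
      eLpNorm_zoomAt hρ y (ρ ^ 2) (q k) 1 h32ne h32top, mul_one]
    calc _ ≤ (‖ρ‖ₑ * (ENNReal.ofReal (ρ ^ 2 * ρ ^ 3)⁻¹) ^ (1 / (3 : ℝ≥0∞).toReal) +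
            ‖ρ ^ 2‖ₑ * (ENNReal.ofReal (ρ ^ 2 * ρ ^ 3)⁻¹) ^ (1 / (3 / 2 : ℝ≥0∞).toReal)) *
          eLpNorm (Function.uncurry (v k)) 3 (volume.restrict (parabolicCylinder ρ ((0 : ℝ), y))) +
          (‖ρ‖ₑ * (ENNReal.ofReal (ρ ^ 2 * ρ ^ 3)⁻¹) ^ (1 / (3 : ℝ≥0∞).toReal) +
            ‖ρ ^ 2‖ₑ * (ENNReal.ofReal (ρ ^ 2 * ρ ^ 3)⁻¹) ^ (1 / (3 / 2 : ℝ≥0∞).toReal)) *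
          eLpNorm (Function.uncurry (q k)) (3 / 2)
            (volume.restrict (parabolicCylinder ρ ((0 : ℝ), y))) := by
          gcongr
          · exact le_self_add
          · exact le_add_self
      _ = _ * (eLpNorm (Function.uncurry (v k)) 3
              (volume.restrict (parabolicCylinder ρ ((0 : ℝ), y))) +
            eLpNorm (Function.uncurry (q k)) (3 / 2)
              (volume.restrict (parabolicCylinder ρ ((0 : ℝ), y)))) := (mul_add _ _ _).symm
      _ ≤ _ := by
          gcongr
          exact le_iSup (fun k => eLpNorm (Function.uncurry (v k)) 3
              (volume.restrict (parabolicCylinder ρ ((0 : ℝ), y))) +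
            eLpNorm (Function.uncurry (q k)) (3 / 2)
              (volume.restrict (parabolicCylinder ρ ((0 : ℝ), y)))) k
  -- (3) per-`R` convergence data on `Q_R(0)`, `0 < R < 1`
  have A4 : ∀ R ∈ Ioo (0 : ℝ) 1,
      IsSuitableWeakSolutionInBall R 0 (ρ • stPull (ρ ^ 2) ρ 0 y ū)
          (ρ ^ 2 • stPull (ρ ^ 2) ρ 0 y pbar) ∧
        Tendsto (fun k => eLpNorm (Function.uncurry (ρ • stPull (ρ ^ 2) ρ 0 y (v k)) -
            Function.uncurry (ρ • stPull (ρ ^ 2) ρ 0 y ū)) 3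
          (volume.restrict (parabolicCylinder R (0 : ℝ × (EuclideanSpace ℝ (Fin 3)))))) atTop (𝓝 0) ∧
        ∀ g : ℝ × (EuclideanSpace ℝ (Fin 3)) → ℝ, MemLp g 3 (volume.restrict (parabolicCylinder R (0 : ℝ × (EuclideanSpace ℝ (Fin 3))))) →
          Tendsto (fun k => ∫ w in parabolicCylinder R (0 : ℝ × (EuclideanSpace ℝ (Fin 3))),
              (ρ ^ 2 • stPull (ρ ^ 2) ρ 0 y (q k)) w.1 w.2 * g w) atTop
            (𝓝 (∫ w in parabolicCylinder R (0 : ℝ × (EuclideanSpace ℝ (Fin 3))),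
              (ρ ^ 2 • stPull (ρ ^ 2) ρ 0 y pbar) w.1 w.2 * g w)) := by
    intro R hR
    have hsub1 : parabolicCylinder R (0 : ℝ × (EuclideanSpace ℝ (Fin 3))) ⊆ parabolicCylinder 1 (0 : ℝ × (EuclideanSpace ℝ (Fin 3))) :=
      parabolicCylinder_mono hR.1.le hR.2.le _
    have hsubρ : parabolicCylinder (ρ * R) ((0 : ℝ), y) ⊆ parabolicCylinder ρ ((0 : ℝ), y) :=
      parabolicCylinder_mono (mul_pos hρ hR.1).le (mul_le_of_le_one_right hρ.le hR.2.le) _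
    have hmeas : MeasurableSet (parabolicCylinder (ρ * R) ((0 : ℝ), y)) :=
      measurableSet_parabolicCylinder' _ _
    refine ⟨A2.of_subset_zero hR.1 hsub1, ?_, ?_⟩
    · have e : ∀ k, eLpNorm (Function.uncurry (ρ • stPull (ρ ^ 2) ρ 0 y (v k)) -
            Function.uncurry (ρ • stPull (ρ ^ 2) ρ 0 y ū)) 3
          (volume.restrict (parabolicCylinder R (0 : ℝ × (EuclideanSpace ℝ (Fin 3))))) =
          ‖ρ‖ₑ * (ENNReal.ofReal (ρ ^ 2 * ρ ^ 3)⁻¹) ^ (1 / (3 : ℝ≥0∞).toReal) *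
            eLpNorm (Function.uncurry (v k) - Function.uncurry ū) 3
              (volume.restrict (parabolicCylinder (ρ * R) ((0 : ℝ), y))) := by
        intro k
        have e1 : Function.uncurry (ρ • stPull (ρ ^ 2) ρ 0 y (v k)) -
            Function.uncurry (ρ • stPull (ρ ^ 2) ρ 0 y ū) =
            Function.uncurry (ρ • stPull (ρ ^ 2) ρ 0 y (v k - ū)) := by
          funext ⟨s, x⟩
          simp only [Pi.sub_apply, Function.uncurry_apply_pair, smul_stPull_apply, smul_sub]
        have e2 : Function.uncurry (v k) - Function.uncurry ū = Function.uncurry (v k - ū) := by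
          funext z; rfl
        rw [e1, e2, eLpNorm_zoomAt hρ y ρ (v k - ū) R (by norm_num) (by norm_num)]
      simp_rw [e]
      have hN : Tendsto (fun k => eLpNorm (Function.uncurry (v k) - Function.uncurry ū) 3
          (volume.restrict (parabolicCylinder (ρ * R) ((0 : ℝ), y)))) atTop (𝓝 0) :=
        tendsto_of_tendsto_of_tendsto_of_le_of_le tendsto_const_nhds h4 (fun _ => zero_le)
          (fun k => eLpNorm_mono_measure _ (Measure.restrict_mono hsubρ le_rfl))
      have := ENNReal.Tendsto.const_mul hN (Or.inr hc3.ne)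
      rwa [mul_zero] at this
    · intro g hg
      set G' : ℝ × (EuclideanSpace ℝ (Fin 3)) → ℝ := (parabolicCylinder (ρ * R) ((0 : ℝ), y)).indicator
        (fun w => g (stAffine (ρ⁻¹ ^ 2) ρ⁻¹ 0 (-(ρ⁻¹ • y)) w)) with hG'
      have hG'mem : MemLp G' 3 (volume.restrict (parabolicCylinder ρ ((0 : ℝ), y))) := by
        rw [hG', memLp_indicator_iff_restrict hmeas, Measure.restrict_restrict hmeas,
          inter_eq_left.2 hsubρ]
        exact memLp_comp_zoomAt_inv hρ y hg
      have key : ∀ f : ℝ → (EuclideanSpace ℝ (Fin 3)) → ℝ,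
          ∫ w in parabolicCylinder R (0 : ℝ × (EuclideanSpace ℝ (Fin 3))), (ρ ^ 2 • stPull (ρ ^ 2) ρ 0 y f) w.1 w.2 * g w =
            ρ ^ 2 * (ρ ^ 2 * ρ ^ 3)⁻¹ *
              ∫ w in parabolicCylinder ρ ((0 : ℝ), y), f w.1 w.2 * G' w := by
        intro f
        rw [setIntegral_zoomAt_pressure_mul hρ y (ρ ^ 2) f g R]
        congr 1
        have : (fun w : ℝ × (EuclideanSpace ℝ (Fin 3)) => f w.1 w.2 * G' w) = (parabolicCylinder (ρ * R) ((0 : ℝ), y)).indicator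
            (fun w => f w.1 w.2 * g (stAffine (ρ⁻¹ ^ 2) ρ⁻¹ 0 (-(ρ⁻¹ • y)) w)) := by
          funext w
          by_cases hw : w ∈ parabolicCylinder (ρ * R) ((0 : ℝ), y) <;> simp [hG', hw]
        rw [this, setIntegral_indicator hmeas, inter_eq_right.2 hsubρ]
      simp_rw [key]
      exact (h5 G' hG'mem).const_mul _
  -- (4) the `limsup = ∞` hypothesis, from the negated conclusion
  by_contra H
  have L : ∀ R ∈ Ioo (0 : ℝ) 1, limsup (fun k => eLpNorm
      (Function.uncurry (ρ • stPull (ρ ^ 2) ρ 0 y (v k))) ⊤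
      (volume.restrict (parabolicCylinder R (0 : ℝ × (EuclideanSpace ℝ (Fin 3)))))) atTop = ⊤ := by
    intro R hR
    by_contra hne
    apply H
    have hb : limsup (fun k => eLpNorm (Function.uncurry (ρ • stPull (ρ ^ 2) ρ 0 y (v k))) ⊤
        (volume.restrict (parabolicCylinder R (0 : ℝ × (EuclideanSpace ℝ (Fin 3)))))) atTop <
        limsup (fun k => eLpNorm (Function.uncurry (ρ • stPull (ρ ^ 2) ρ 0 y (v k))) ⊤
          (volume.restrict (parabolicCylinder R (0 : ℝ × (EuclideanSpace ℝ (Fin 3)))))) atTop + 1 :=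
      ENNReal.lt_add_right hne one_ne_zero
    set B : ℝ≥0∞ := limsup (fun k => eLpNorm (Function.uncurry (ρ • stPull (ρ ^ 2) ρ 0 y (v k))) ⊤
        (volume.restrict (parabolicCylinder R (0 : ℝ × (EuclideanSpace ℝ (Fin 3)))))) atTop + 1 with hBdef
    have hBtop : B ≠ ⊤ := ENNReal.add_ne_top.2 ⟨hne, ENNReal.one_ne_top⟩
    have hev : ∀ᶠ k in atTop, eLpNorm (Function.uncurry (ρ • stPull (ρ ^ 2) ρ 0 y (v k))) ⊤
        (volume.restrict (parabolicCylinder R (0 : ℝ × (EuclideanSpace ℝ (Fin 3))))) < B := eventually_lt_of_limsup_lt hb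
    refine ⟨ρ * R, mul_pos hρ hR.1, B.toReal / ρ, ?_⟩
    filter_upwards [hev] with k hk
    have hae : ∀ᵐ z ∂(volume.restrict (stAffine (ρ ^ 2) ρ 0 y ⁻¹'
        parabolicCylinder (ρ * R) ((0 : ℝ), y))),
        ‖ρ • v k (stAffine (ρ ^ 2) ρ 0 y z).1 (stAffine (ρ ^ 2) ρ 0 y z).2‖ ≤ B.toReal := by
      rw [preimage_zoomAt hρ y R]
      filter_upwards [enorm_ae_le_eLpNormEssSup (Function.uncurry (ρ • stPull (ρ ^ 2) ρ 0 y (v k)))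
        (volume.restrict (parabolicCylinder R (0 : ℝ × (EuclideanSpace ℝ (Fin 3)))))] with z hz
      rw [← eLpNorm_exponent_top] at hz
      have hz' := hz.trans hk.le
      rw [← ofReal_norm] at hz'
      exact (ENNReal.ofReal_le_iff_le_toReal hBtop).1 hz'
    have h7 := ae_restrict_of_ae_restrict_preimage_stAffine hρ2 hρ 0 y
      (P := fun w => ‖ρ • v k w.1 w.2‖ ≤ B.toReal) hae
    filter_upwards [h7] with w hw
    rw [norm_smul, Real.norm_eq_abs, abs_of_pos hρ] at hw
    rw [le_div_iff₀ hρ, mul_comm]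
    exact hw
  -- (5) the fact, and the contradiction with the bound on `ū` near `(0, y)`
  have hsing := PersistenceOfSingularities_holds _ _ _ _ A1 A3 A4 L
  obtain ⟨r₀, hr₀, M₀, hM₀⟩ := h6
  have h8 := ae_restrict_preimage_stAffine hρ2 hρ 0 y (S := parabolicCylinder r₀ ((0 : ℝ), y))
    (P := fun w => ‖ū w.1 w.2‖ ≤ M₀) hM₀
  have hpre : stAffine (ρ ^ 2) ρ 0 y ⁻¹' parabolicCylinder r₀ ((0 : ℝ), y) =
      parabolicCylinder (r₀ / ρ) (0 : ℝ × (EuclideanSpace ℝ (Fin 3))) := by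
    have := preimage_zoomAt hρ y (r₀ / ρ)
    rwa [mul_div_cancel₀ _ hρne] at this
  rw [hpre] at h8
  have h9 : ∀ᵐ z ∂(volume.restrict (parabolicCylinder (r₀ / ρ) (0 : ℝ × (EuclideanSpace ℝ (Fin 3))))),
      ‖Function.uncurry (ρ • stPull (ρ ^ 2) ρ 0 y ū) z‖ ≤ ρ * M₀ := by
    filter_upwards [h8] with z hz
    show ‖ρ • ū (stAffine (ρ ^ 2) ρ 0 y z).1 (stAffine (ρ ^ 2) ρ 0 y z).2‖ ≤ ρ * M₀
    rw [norm_smul, Real.norm_eq_abs, abs_of_pos hρ]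
    exact mul_le_mul_of_nonneg_left hz hρ.le
  have h10 := eLpNormEssSup_lt_top_of_ae_bound h9
  have h11 := hsing (r₀ / ρ) (div_pos hr₀ hρ)
  rw [eLpNorm_exponent_top] at h11
  exact h10.ne h11

end PersistenceBridge

/-! ### The dictionary with F2 and F3 discharged -/

/-- **The dictionary, ν = 1, F1–F3 all tree theorems.**  Hypotheses: `0 < T`, continuity of `u` on
the strip, the Type-I rate, and the two `u`-side classes (`ZoomsInBall`, `ZoomsBddU`). -/
theorem dictionaryU' (hT : 0 < T) (hcont : ContinuousOn (Function.uncurry u) (Ioo 0 T ×ˢ univ))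
    (hTI : IsTypeIBlowup u T) (hZ : ZoomsInBall u p a T) (hB : ZoomsBddU u p a T) :
    BudgetAt 1 T u a ↔ ∀ L ū, TangentU u p a T L ū → ∀ y ∈ unitAnn, RegU ū y :=
  dictionaryU hT hcont hTI hZ hB persistenceU_holds localESSU_holds

/-- The same for the tree's `OctaveBudget 1 T u`. -/
theorem octaveBudget_iff_noSatelliteU' (hT : 0 < T)
    (hcont : ContinuousOn (Function.uncurry u) (Ioo 0 T ×ˢ univ)) (hTI : IsTypeIBlowup u T)
    (hZ : ∀ a, ZoomsInBall u p a T) (hB : ∀ a, ZoomsBddU u p a T) :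
    Summit.NavierStokesRegularity.NavierStokesRegularity.Cruxes.ScarEnvelopeTypeI.SliceBudget.OctaveBudget
        1 T u ↔
      ∀ a, Summit.NavierStokesRegularity.NavierStokesRegularity.Cruxes.ScarEnvelopeTypeI.SliceBudget.SingularPt
          T u a → ∀ L ū, TangentU u p a T L ū → ∀ y ∈ unitAnn, RegU ū y :=
  octaveBudget_iff_noSatelliteU hT hcont hTI hZ hB persistenceU_holds localESSU_holds

/-- **Classical Leray–Hopf Type-I solutions on `[0,T)` (ν = 1): the dictionary modulo ONLY the vertex
bounds** `C(r; (T,a); u) ≤ M`, `D(r; (T,a); p_gauged) ≤ D`, `0 < r ≤ r₁`. -/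
theorem dictionaryU_of_classical' (hT : 0 < T) (hsol : IsClassicalNSSolutionOn (Ico 0 T) 1 0 u p)
    (hLH : IsLerayHopfOn T 1 0 (u 0) u) (hTI : IsTypeIBlowup u T)
    {M D : ℝ≥0∞} (hMt : M < ⊤) (hDt : D < ⊤) {r₁ : ℝ} (hr₁ : 0 < r₁)
    (hM : ∀ r, 0 < r → r ≤ r₁ → cknC r ((T, a) : ℝ × (EuclideanSpace ℝ (Fin 3))) u ≤ M)
    (hD : ∀ r, 0 < r → r ≤ r₁ →
      cknD r ((T, a) : ℝ × (EuclideanSpace ℝ (Fin 3))) (fun t x => p t x - (p t 0 - normalisedPressure (u t) 0)) ≤ D) :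
    BudgetAt 1 T u a ↔
      ∀ L ū, TangentU u (fun t x => p t x - (p t 0 - normalisedPressure (u t) 0)) a T L ū →
        ∀ y ∈ unitAnn, RegU ū y :=
  dictionaryU_of_classical hT hsol hLH hTI hMt hDt hr₁ hM hD persistenceU_holds localESSU_holds

end UnitNormalisation

end Summit.NavierStokesRegularity.NavierStokesRegularity.Cruxes.ScarEnvelopeTypeI.ZoomDictionary
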